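import Summits.BirchSwinnertonDyer.BirchSwinnertonDyer.Theorems.PrintCf2RamifiedOffTYZInvisibleGeneratorArith
import Summits.BirchSwinnertonDyer.BirchSwinnertonDyer.Theorems.PrintCf2RamifiedOffTYZGeneratorDepthRhoOne
import Literature.NumberTheory.EllipticCurves.TwoDescent
import HarnessLib

/-!
# Route `PrintCf2`, crux stmt-BirchSwinnertonDyer-20509 `RamifiedOffTYZOfFacts` — THE INVISIBLE GENERATOR, part 2: **`d(h) = 2 ⟹ [α_n] = 0`**
# (the GENERATOR half of the census law (GP), for EVERY square-free `n > 1`, no Lemma 3.18, no block-freeness), and C⁺ on the invisible special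
# stratum of the block-free family ⟺ `depth P(n) = 1`
# (cell `bsd-print-cf2`, LEAD of 20509 g18, line `offtyz-v7`, lineage cycle 19; fact-free, Theses-free, no `def`)

HONEST FRAMING (crux 20509 = `𝔅_ram → WAllCornerFTwoRamifiedOffTYZProved`, DECIDING, OPEN AS A CLASS; C⁺ = `stub_offTYZ_levelTwoScriptLExact` = item
stmt-BirchSwinnertonDyer-23431: on the jump-one rank-one class `2 ∥ 𝓛(n)`; OPEN, equivalent to `BSD(E_n, 2)` there).  Pure algebra on TYZ's curve
`A = curveA : Y² = X³ + 4X` over the displayed field `ℍ′_n = D.H` (`D : GenusPointData n`; only `i, √−d (d ∣ n) ∈ ℍ′_n` are used in §2), the tree's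
complete `2`-descent (`Literature/…/TwoDescent`, Silverman X.1.4), the twist transfer `Θ_A : A_n(ℚ) → A(K_n)⁻` of the W2 kernel, and part 1's
arithmetic lemma.  §3's second and third theorems add the displays Thm. 3.5 / integrality / Lemma 3.18 (`D.Printed`), the compositum sentence
(`D.CMPointCompositumPrinted`, block-free ⟹ `Gal(ℍ′_n/ℚ)` commutative) and GZK as HYPOTHESES, as in the rest of the line.  Nothing is asserted; no
named fact is introduced.

THE LAW.  The LEAD g17 census (`Lines/offtyz_v7_GenusPeriodBit.md` §11; 117/117 on R2) and cycle 19's `k = 3` rows found (GP): «`[Z(n)] = 0 ⟺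
d(h) = 2`» where `d(h) = [X(h)] ∈ ℚ^×/ℚ^{×2}` is the `2`-isogeny descent class of the generator `h = (X, Y)` of `A_n(ℚ)` modulo torsion
(`A_n : Y² = X³ + 4n²X`).  Through g2's `[Z(n)] = u·[α_n]` its GENERATOR half is «`d(h) = 2 ⟹ [α_n] = 0`», i.e. `X(h) ∈ 2ℚ^{×2} ⟹ ι Θ_A(h) ∈
2A(ℍ′_n) + A(ℍ′_n)_tor`; g16 proved the converse on the block-free family (`…VisibleGenerator`: `[α_n] = 0 ⟹ X(h) ∈ ℚ² ∪ 2ℚ²`).  THIS FILE proves it: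

* §2 `twoDivisible_of_two_sq` — **square-free `n > 1`, `s ≠ 0`, `w > 0` with `2w² = s⁴ + n²`, ANY `ℍ′_n`-point `α = (−2s²/n, Y)` of `A` ⟹
  `α ∈ 2A(ℍ′_n) + A(ℍ′_n)_tor`.**  The descent pair of `α` at `(2i,0), (0,0)` is `([(1 − i)u], [2])` with `2w + s² + n = u·t²`, `u ∣ 2n` (part 1):
  `(x − 2i)(1 − i)(u t²)(−n) = (c + (n − s²)i)²`, `c = 2w + s² + n`, and `2x(−n) = (2s)²`; the torsion points `τ(½) = (2,4) ↦ ([2(1−i)], [2])`,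
  `T⁺ = (2i,0) ↦ ([2], [1])`; divisors of `n` are squares in `ℍ′_n`; so `α − τ(½)` (`u` even) or `α − τ(½) − T⁺` (`u` odd) has trivial descent
  pair and is `2Q` by `exists_add_self_of_twoDescentComponent_eq_one`.
* §3 `twoDivisible_map_ΘA_of_X_eq_two_mul_sq` — **`h = (2s², Y) ∈ A_n(ℚ)` ⟹ `[ι Θ_A(h)] = 0`** (`w = |Y/(4s)|` from the curve equation);
  `depth_eq_one_of_X_eq_two_mul_sq` — on the block-free family (Lemma 3.18, `Gal` commutative) `d(h) = 2 ⟹ depth(α_n) = 1` EXACTLY (with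
  `GeneratorDepth.not_fourDivisible_map_ΘA`); ★ `levelTwo_iff_depth_genusPoint_eq_one_of_X_eq_two_mul_sq` — **on the invisible special stratum
  (`ρ(n) = 0`, `d(h) = 2`) of the block-free jump-one class, the conclusion of C⁺ at `n` ⟺ `P(n) ∈ 2A(ℍ′_n) + tors ∧ P(n) ∉ 4A(ℍ′_n) + tors`**
  (`…LevelTwoDepth`: C⁺ ⟺ «depth P(n) = depth Q₁», and `depth Q₁ = 1`).

What this buys the line (LEAD census, crux 20509): with g16 and the valve, on the block-free family **`[α_n] = 0 ⟺ d(h) ∈ {1, 2}`** and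
`depth α_n = [d(h) ∈ {1,2}]` are THEOREMS; the three strata of the jump-one class are decided by `d(h)` alone, and on each of them C⁺ is an explicit
statement about the depth of TYZ's point `P(n)` (`d(h) ∉ {1,2}`: `[P(n)] ≠ 0`; `d(h) = 1`: `[P(n)] ≠ 0`; `d(h) = 2`: `depth P(n) = 1`).  The genus side
— the census law (GP) proper, «`d(h) = 2 ⟹ [Z(n)] = 0`» and its converse — is the lower/upper half of C⁺ itself and stays OPEN.  Beyond-print theorem:
YES, modest (a `2`-descent identity the source does not state; §2 unconditional, §3 conditional on the displays).  BSD is not proved by any of this;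
C⁺ / crux 20509 stay OPEN; no class is closed by this file.

References: [cite: TianYuanZhang2017, §1 (arXiv:1411.4728 chunk p0002 L101–L110: `ρ(n)`, `φ_n : A_n → E_n`), §3.1 (p0011 L27–L36: `A(K_n)⁻`, `α_n`;
p0011 L58–L66: `ℍ′_n ⊇ L_n(i) = ℚ(i, √d : d ∣ n)`), §3.2 (p0012 L12–L18: `τ`), Thm. 3.5 (p0011 L94–L100), Lemma 3.16 (p0017 L98–L113), Lemma 3.18
(p0017 L152–L153)]; [cite: SilvermanAEC2009, Prop. X.1.4 (complete `2`-descent), Prop. X.4.9]; [cite: Darmon2004, Thm. 3.22] (GZK, binder `hGZK`);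
[cite: Lang2002, VI §1 Thm. 1.2, Cor. 1.4]; tree: `Literature/…/TwoDescent` (`twoDescentComponent_add`, `exists_add_self_of_twoDescentComponent_eq_one`),
`…VisibleGenerator` (g16: `splitTwoTorsion_curveA`, the converse direction), `…LowerHalfVisibleSeven` (g16: `exists_map_ΘA_eq_some`, `Atwo_equation`,
`generatesFreePart_ΘA`), `…LevelTwoRhoValve` (g3), `…LevelTwoDepth` (g3), `…GeneratorDepth{,RhoOne}` (this seat, cycle 19), LEAD memo
`Cruxes/RamifiedOffTYZOfFacts/Lines/offtyz_v7_GeneratorDepth.md` §4–§6.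
-/

noncomputable section

open scoped Classical

open WeierstrassCurve WeierstrassCurve.Affine WeierstrassCurve.Affine.Point
  Literature.NumberTheory.EllipticCurves Literature.NumberTheory.EllipticCurves.Rank1Residual
  Summit.BirchSwinnertonDyer.Rank1Residual
  Literature.NumberTheory.EllipticCurves.TianYuanZhang2017
  Literature.NumberTheory.EllipticCurves.TianYuanZhang2017.W2
  Summit.BirchSwinnertonDyer.PrintCf2.GaloisMotion
  Summit.BirchSwinnertonDyer.Rank1Residual.P2.ThetaDescent
  Summit.BirchSwinnertonDyer.PrintCf2.LowerHalfVisible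
  Summit.BirchSwinnertonDyer.PrintCf2.VisibleGenerator

set_option autoImplicit false

namespace Summit.BirchSwinnertonDyer.PrintCf2.InvisibleGenerator

variable {n : ℕ}

/-! ## §2 Square classes in `ℍ′_n` and the `2`-descent of `A : Y² = X³ + 4X` at `X = −2s²/n` -/

/-- `a·b = z²` with `a, b ≠ 0` gives equal square classes `[a] = [b]`. [folklore] -/
private theorem sqClass_eq_of_mul_eq_sq {F : Type*} [Field F] {a b z : F} (ha : a ≠ 0) (hb : b ≠ 0) (h : a * b = z ^ 2) :
    sqClass a = sqClass b := by
  have h1 : sqClass a * sqClass b = 1 := by rw [← sqClass_mul ha hb, h, sqClass_sq]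
  calc sqClass a = sqClass a * (sqClass b * sqClass b) := by rw [SqUnits.mul_self, SqUnits.mul_one]
    _ = (sqClass a * sqClass b) * sqClass b := by rw [mul_assoc]
    _ = sqClass b := by rw [h1, SqUnits.one_mul]

/-- A divisor `d` of `n` is a square in `ℍ′_n`: `(√−d · i)² = d`. [cite: TianYuanZhang2017, §3.1 (p0011 L60–L64: L_n(i) = ℚ(i, √d : d ∣ n))] -/
theorem sqClass_natCast_eq_one_of_dvd (D : GenusPointData n) (hn0 : n ≠ 0) {d : ℕ} (hd : d ∣ n) (hd0 : d ≠ 0) :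
    sqClass ((d : ℕ) : D.H) = 1 := by
  have hdm : d ∈ n.divisors := Nat.mem_divisors.mpr ⟨hd, hn0⟩
  have hdH : ((d : ℕ) : D.H) ≠ 0 := by exact_mod_cast hd0
  rw [sqClass_eq_one_iff hdH]
  exact ⟨D.sqrtNeg d * D.im, by rw [mul_pow, D.sqrtNeg_sq d hdm, D.im_sq]; ring⟩

/-- `A/ℍ′_n` is an elliptic curve (instance plumbing for the descent homomorphism). [folklore] -/
private theorem isElliptic_curveA_baseChange' (D : GenusPointData n) : (curveA.baseChange D.H).IsElliptic :=
  inferInstanceAs (curveA.map (algebraMap ℚ D.H)).IsElliptic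

/-- **THE `2`-DESCENT AT `X = −2s²/n`.**  Data `D : GenusPointData n` (`i`, `√−d` for `d ∣ n` in `ℍ′_n`), square-free `n > 1`, rationals `s ≠ 0`,
`w > 0` with `2w² = s⁴ + n²`, and ANY `ℍ′_n`-point `α = (x, Y)` of `A` with `x = −2s²/n`.  Then **`α ∈ 2A(ℍ′_n) + A(ℍ′_n)_tor`**: explicitly
`α − τ(½) ∈ 2A(ℍ′_n)` or `α − τ(½) − T⁺ ∈ 2A(ℍ′_n)` (`τ(½) = (2,4)`, `T⁺ = (2i,0)`).  MECHANISM: the descent pair of `α` at `(2i, 0), (0,0)` is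
`([x − 2i], [x]) = ([(1−i)·u], [2])` where `2w + s² + n = u·t²`, `u ∣ 2n` (§1) — because `(x − 2i)(1 − i)(2w + s² + n)·(−n) = (c + (n − s²)i)²`
with `c = 2w + s² + n` (the norm `s⁴ + n² = 2w²` read through Hilbert 90 for `ℚ(i)/ℚ`) and `2x·(−n) = (2s)²` — while `τ(½) ↦ ([2(1−i)], [2])`,
`T⁺ ↦ ([−8], [2i]) = ([2], [1])`, and every divisor of `n` is a square in `ℍ′_n ⊇ L_n(i)`.
[cite: SilvermanAEC2009, Prop. X.1.4] [cite: TianYuanZhang2017, §3.1 (p0011 L60–L64), §3.2 (p0012 L12–L18), Lemma 3.16 (p0017 L98–L113)] -/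
theorem twoDivisible_of_two_sq (hsq : Squarefree n) (hn1 : 1 < n) (D : GenusPointData n) {s w : ℚ} (hs : s ≠ 0)
    (hw : 0 < w) (h : 2 * w ^ 2 = s ^ 4 + (n : ℚ) ^ 2)
    {Y : D.H} (hP : (curveA.baseChange D.H).toAffine.Nonsingular (algebraMap ℚ D.H (-(2 * s ^ 2) / n)) Y) :
    ∃ y : APoint D.H, IsOfFinAddOrder ((Point.some _ _ hP : APoint D.H) - (2 : ℤ) • y) := by
  haveI := isElliptic_curveA_baseChange' D
  have hST := splitTwoTorsion_curveA D
  have him := D.im_sq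
  have hn0 : n ≠ 0 := by omega
  have hn : n ∈ n.divisors := Nat.mem_divisors_self n hn0
  have hnH : (n : D.H) ≠ 0 := by exact_mod_cast hn0
  have hsn := D.sqrtNeg_sq n hn
  have hsn0 : D.sqrtNeg n ≠ 0 := fun h0 => by rw [h0, zero_pow two_ne_zero, zero_eq_neg] at hsn; exact hnH hsn
  have hi0 : D.im ≠ 0 := fun h0 => by rw [h0, zero_pow two_ne_zero] at him; norm_num at him
  -- §1: `2w + s² + n = u t²`, `u ∣ 2n`
  obtain ⟨u, t, hu2n, hct⟩ := exists_dvd_two_mul_and_eq_mul_sq hsq hn1 hw h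
  have hc0 : (0 : ℚ) < 2 * w + s ^ 2 + n := by positivity
  have hu0 : u ≠ 0 := by rintro rfl; rw [Nat.cast_zero, zero_mul] at hct; exact hc0.ne' hct
  have ht0 : t ≠ 0 := by rintro rfl; rw [zero_pow two_ne_zero, mul_zero] at hct; exact hc0.ne' hct
  -- names in `ℍ′_n`
  set σ : D.H := algebraMap ℚ D.H s with hσ
  set ω : D.H := algebraMap ℚ D.H w with hω
  set τ : D.H := algebraMap ℚ D.H t with hτ
  set x : D.H := algebraMap ℚ D.H (-(2 * s ^ 2) / n) with hxdef
  have hx : x = -(2 * σ ^ 2) / n := by rw [hxdef, map_div₀, map_neg, map_mul, map_pow, map_ofNat, map_natCast]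
  have hσ0 : σ ≠ 0 := by rw [hσ]; exact (map_ne_zero _).mpr hs
  have hτ0 : τ ≠ 0 := by rw [hτ]; exact (map_ne_zero _).mpr ht0
  have hwH : 2 * ω ^ 2 = σ ^ 4 + (n : D.H) ^ 2 := by
    have := congrArg (algebraMap ℚ D.H) h
    rw [map_mul, map_pow, map_add, map_pow, map_pow, map_ofNat, map_natCast] at this; exact this
  have hcH : 2 * ω + σ ^ 2 + n = (u : D.H) * τ ^ 2 := by
    have := congrArg (algebraMap ℚ D.H) hct
    rw [map_add, map_add, map_mul, map_pow, map_mul, map_pow, map_ofNat, map_natCast, map_natCast] at this; exact this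
  have hx0 : x ≠ 0 := by
    rw [hx]; exact div_ne_zero (neg_ne_zero.mpr (mul_ne_zero two_ne_zero (pow_ne_zero 2 hσ0))) hnH
  have hx2i : x ≠ 2 * D.im := by
    intro e
    have e2 : x ^ 2 = -4 := by rw [e, mul_pow, him]; norm_num
    have e3 : algebraMap ℚ D.H ((-(2 * s ^ 2) / n) ^ 2) = algebraMap ℚ D.H (-4) := by rw [map_pow, ← hxdef, e2, map_neg, map_ofNat]
    have e4 : (-(2 * s ^ 2) / n) ^ 2 = -4 := (algebraMap ℚ D.H).injective e3
    nlinarith [sq_nonneg (-(2 * s ^ 2) / (n : ℚ))]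
  -- the two square classes of `α`
  have hcl2 : sqClass x = sqClass (2 : D.H) := by
    refine sqClass_eq_of_mul_eq_sq hx0 two_ne_zero (z := 2 * σ * (D.sqrtNeg n)⁻¹) ?_
    rw [mul_pow, mul_pow, inv_pow, hsn, hx]; field_simp
  have hcl1 : sqClass (x - 2 * D.im) = sqClass ((1 - D.im) * u) := by
    have h1i0 : (1 : D.H) - D.im ≠ 0 := by
      intro e; have : D.im = 1 := by linear_combination -e
      rw [this] at him; norm_num at him
    have huH : (u : D.H) ≠ 0 := by exact_mod_cast hu0
    refine sqClass_eq_of_mul_eq_sq (sub_ne_zero.mpr hx2i) (mul_ne_zero h1i0 huH)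
      (z := ((2 * ω + σ ^ 2 + n) + ((n : D.H) - σ ^ 2) * D.im) * (D.sqrtNeg n)⁻¹ * τ⁻¹) ?_
    -- `(x − 2i)·(−n) = 2σ² + 2 i n`, and `(2σ² + 2in)(1 − i)·c = (c + (n − σ²) i)²` for `c = 2ω + σ² + n`
    have hx' : (x - 2 * D.im) * (-(n : D.H)) = 2 * σ ^ 2 + 2 * D.im * n := by
      rw [hx]; field_simp; ring
    have key : (x - 2 * D.im) * ((1 - D.im) * ((u : D.H) * τ ^ 2)) * (-(n : D.H)) =
        ((2 * ω + σ ^ 2 + n) + ((n : D.H) - σ ^ 2) * D.im) ^ 2 := by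
      rw [← hcH, show (x - 2 * D.im) * ((1 - D.im) * (2 * ω + σ ^ 2 + n)) * (-(n : D.H)) =
        ((x - 2 * D.im) * (-(n : D.H))) * ((1 - D.im) * (2 * ω + σ ^ 2 + n)) by ring, hx']
      linear_combination (-(2 * (n : D.H) * (2 * ω + σ ^ 2 + n)) - ((n : D.H) - σ ^ 2) ^ 2) * him - 2 * hwH
    rw [mul_pow, mul_pow, inv_pow, inv_pow, hsn, ← key]; field_simp
  -- descent components of `α`, `τ(½) = (2,4)`, `T⁺ = (2i,0)`
  set δ₁ := twoDescentComponent (curveA.baseChange D.H).toAffine (2 * D.im) 0 (-(2 * D.im)) with hδ₁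
  set δ₂ := twoDescentComponent (curveA.baseChange D.H).toAffine 0 (2 * D.im) (-(2 * D.im)) with hδ₂
  have hα₁ : δ₁ (Point.some _ _ hP) = sqClass ((1 - D.im) * u) := by
    rw [hδ₁, twoDescentComponent_some_of_ne hP hx2i, hcl1]
  have hα₂ : δ₂ (Point.some _ _ hP) = sqClass (2 : D.H) := by
    rw [hδ₂, twoDescentComponent_some_of_ne hP hx0, sub_zero, hcl2]
  have h2ne : (2 : D.H) ≠ 2 * D.im := by
    intro e; have : D.im = 1 := by linear_combination -e / 2
    rw [this] at him; norm_num at him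
  have hτ₁ : δ₁ (tauHalf : APoint D.H) = sqClass ((1 - D.im) * 2) := by
    rw [hδ₁, tauHalf, twoDescentComponent_some_of_ne _ h2ne]; congr 1; ring
  have hτ₂ : δ₂ (tauHalf : APoint D.H) = sqClass (2 : D.H) := by
    rw [hδ₂, tauHalf, twoDescentComponent_some_of_ne _ (two_ne_zero : (2 : D.H) ≠ 0), sub_zero]
  have h2i0 : (2 : D.H) * D.im ≠ 0 := mul_ne_zero two_ne_zero hi0
  have hT₁ : δ₁ (tPlus D.im D.im_sq : APoint D.H) = sqClass (2 : D.H) := by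
    rw [hδ₁, tPlus, twoDescentComponent_some_of_eq _ rfl]
    have e : (2 * D.im - 0) * (2 * D.im - -(2 * D.im)) = (-8 : D.H) := by linear_combination 8 * him
    rw [e]
    exact sqClass_eq_of_mul_eq_sq (by norm_num) two_ne_zero (z := 4 * D.im) (by linear_combination (-16) * him)
  have hT₂ : δ₂ (tPlus D.im D.im_sq : APoint D.H) = 1 := by
    rw [hδ₂, tPlus, twoDescentComponent_some_of_ne _ h2i0, sub_zero, sqClass_eq_one_iff h2i0]
    exact ⟨1 + D.im, by linear_combination -him⟩
  -- torsion facts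
  have htH : IsOfFinAddOrder (tauHalf : APoint D.H) := by
    refine isOfFinAddOrder_iff_nsmul_eq_zero.mpr ⟨4, by norm_num, ?_⟩
    rw [show (4 : ℕ) = 2 * 2 from rfl, mul_nsmul, two_nsmul_tauHalf, two_nsmul_tauOne]
  have htP : IsOfFinAddOrder (tPlus D.im D.im_sq : APoint D.H) := by
    refine isOfFinAddOrder_iff_nsmul_eq_zero.mpr ⟨2, two_pos, ?_⟩
    rw [two_nsmul, tPlus]; exact Point.add_of_Y_eq rfl (by simp [negY])
  -- finish: a torsion point `t₀` with `α − t₀ ∈ 2A(ℍ′_n)`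
  have finish : ∀ t₀ : APoint D.H, IsOfFinAddOrder t₀ →
      δ₁ (Point.some _ _ hP - t₀) = 1 → δ₂ (Point.some _ _ hP - t₀) = 1 →
      ∃ y : APoint D.H, IsOfFinAddOrder ((Point.some _ _ hP : APoint D.H) - (2 : ℤ) • y) := by
    intro t₀ ht₀ h1 h2
    obtain ⟨Q, hQ⟩ := exists_add_self_of_twoDescentComponent_eq_one hST _ h1 h2
    refine ⟨Q, ?_⟩
    have e : (Point.some _ _ hP : APoint D.H) - (2 : ℤ) • Q = t₀ := by rw [two_zsmul, hQ]; abel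
    rw [e]; exact ht₀
  rcases Nat.even_or_odd u with ⟨u', hu'⟩ | hoddu
  · -- `u = 2u'`, `u' ∣ n`: `t₀ = τ(½)`
    have hu'n : u' ∣ n := Nat.dvd_of_mul_dvd_mul_left two_pos (by rw [two_mul, ← hu']; exact hu2n)
    have hu'0 : u' ≠ 0 := by rintro rfl; exact hu0 (by rw [hu'])
    have hcu : sqClass ((1 - D.im) * u) = sqClass ((1 - D.im) * 2) := by
      have h1i0 : (1 : D.H) - D.im ≠ 0 := by
        intro e; have : D.im = 1 := by linear_combination -e
        rw [this] at him; norm_num at him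
      rw [hu', show (((u' + u' : ℕ) : D.H)) = 2 * (u' : D.H) by push_cast; ring, ← mul_assoc,
        sqClass_mul (mul_ne_zero h1i0 two_ne_zero) (by exact_mod_cast hu'0), sqClass_natCast_eq_one_of_dvd D hn0 hu'n hu'0,
        SqUnits.mul_one]
    refine finish tauHalf htH ?_ ?_
    · rw [sub_eq_add_neg, hδ₁, twoDescentComponent_add hST, twoDescentComponent_neg, ← hδ₁, hα₁, hτ₁, hcu, SqUnits.mul_self]
    · rw [sub_eq_add_neg, hδ₂, twoDescentComponent_add hST.swap₁₂, twoDescentComponent_neg, ← hδ₂, hα₂, hτ₂, SqUnits.mul_self]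
  · -- `u` odd, `u ∣ n`: `t₀ = τ(½) + T⁺`
    have hun : u ∣ n := (Odd.coprime_two_right hoddu).dvd_of_dvd_mul_left hu2n
    have h1i0 : (1 : D.H) - D.im ≠ 0 := by
      intro e; have : D.im = 1 := by linear_combination -e
      rw [this] at him; norm_num at him
    have hcu : sqClass ((1 - D.im) * u) = sqClass (1 - D.im) := by
      rw [sqClass_mul h1i0 (by exact_mod_cast hu0), sqClass_natCast_eq_one_of_dvd D hn0 hun hu0, SqUnits.mul_one]
    have h12 : sqClass ((1 - D.im) * 2) = sqClass (1 - D.im) * sqClass (2 : D.H) := sqClass_mul h1i0 two_ne_zero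
    refine finish (tauHalf + tPlus D.im D.im_sq) (htH.add htP) ?_ ?_
    · rw [sub_eq_add_neg, hδ₁, twoDescentComponent_add hST, twoDescentComponent_neg, twoDescentComponent_add hST, ← hδ₁,
        hα₁, hτ₁, hT₁, hcu, h12]
      rw [show sqClass (1 - D.im) * (sqClass (1 - D.im) * sqClass (2 : D.H) * sqClass (2 : D.H)) =
        (sqClass (1 - D.im) * sqClass (1 - D.im)) * (sqClass (2 : D.H) * sqClass (2 : D.H)) by
          simp only [mul_assoc], SqUnits.mul_self, SqUnits.mul_self, SqUnits.mul_one]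
    · rw [sub_eq_add_neg, hδ₂, twoDescentComponent_add hST.swap₁₂, twoDescentComponent_neg, twoDescentComponent_add hST.swap₁₂,
        ← hδ₂, hα₂, hτ₂, hT₂, SqUnits.mul_one, SqUnits.mul_self]


/-! ## §3 The generator side of the line: `d(h) = 2 ⟹ [α_n] = 0` (the census law (GP), generator half), and C⁺ on the invisible stratum -/

/-- **`d(h) = 2 ⟹ [α_n] = 0`.**  Square-free `n > 1`, data `D : GenusPointData n` (only the field `ℍ′_n ∋ i, √−d (d ∣ n)` is used — NO
Lemma 3.18, NO block-freeness), and a rational point `h = (X, Y) ∈ A_n(ℚ)` (`A_n : Y² = X³ + 4n²X`) with **`X = 2s²`**, `s ≠ 0` (descent class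
`d(h) = 2`).  Then `α := ι Θ_A(h)` is `2`-DIVISIBLE in `A(ℍ′_n)` modulo torsion: `[α] = 0` in `A(ℍ′_n)/(2A(ℍ′_n) + A(ℍ′_n)_tor)`.  (The LEAD g17
census law (GP) «`[Z(n)] = 0 ⟺ d(h) = 2`» has, through g2's reading `[Z(n)] = u·[α_n]`, the GENERATOR half «`d(h) = 2 ⟹ [α_n] = 0`» — this
theorem — 117/117 on R2 and 16/16 on the block-free `k = 3` rows of cycle 19.)
[cite: SilvermanAEC2009, Prop. X.1.4, X.4.9] [cite: TianYuanZhang2017, §1 (p0002 L101–L110), §3.1 (p0011 L27–L36, L60–L64), Lemma 3.16 (p0017 L98–L113)] -/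
theorem twoDivisible_map_ΘA_of_X_eq_two_mul_sq (hsq : Squarefree n) (hn1 : 1 < n) (D : GenusPointData n)
    {X Y : ℚ} (h : (Atwo n).toAffine.Nonsingular X Y) {s : ℚ} (hs : s ≠ 0) (hX : X = 2 * s ^ 2) :
    ∃ y : APoint D.H, IsOfFinAddOrder
      (Point.map (W' := curveA) (D.embK n (Nat.mem_divisors_self n hsq.ne_zero)) (ΘA hsq.ne_zero (Point.some X Y h)) - (2 : ℤ) • y) := by
  subst hX
  have heq := Atwo_equation h
  have hY0 : Y ≠ 0 := by
    intro hY
    rw [hY] at heq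
    have : (0 : ℚ) < (2 * s ^ 2) ^ 3 + 4 * (n : ℚ) ^ 2 * (2 * s ^ 2) := by positivity
    rw [← heq] at this; norm_num at this
  set w : ℚ := |Y / (4 * s)| with hwdef
  have hw : 0 < w := abs_pos.mpr (div_ne_zero hY0 (mul_ne_zero four_ne_zero hs))
  have h2w : 2 * w ^ 2 = s ^ 4 + (n : ℚ) ^ 2 := by
    have e : 2 * w ^ 2 = Y ^ 2 / (8 * s ^ 2) := by rw [hwdef, sq_abs, div_pow]; ring
    rw [e, heq]; field_simp; ring
  obtain ⟨Y', hP, hmap⟩ := exists_map_ΘA_eq_some hsq D h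
  rw [hmap]
  exact twoDivisible_of_two_sq hsq hn1 D hs hw h2w hP

/-- **ON THE BLOCK-FREE FAMILY, `d(h) = 2 ⟹ depth(α_n) = 1` EXACTLY** (law (D1′)∧(GP), generator side): square-free odd `n > 1`, Lemma 3.18,
`Gal(ℍ′_n/ℚ)` commutative, `h = (2s², Y)` a non-torsion generator of `A_n(ℚ)` modulo torsion ⟹ `α = ι Θ_A(h) ∈ 2A(ℍ′_n) + tors` and
`α ∉ 4A(ℍ′_n) + tors` (this file + `GeneratorDepth.not_fourDivisible_map_ΘA`).
[cite: TianYuanZhang2017, §3.1 (p0011 L27–L36, L58–L66), Lemma 3.18 (p0017 L152–L153)] [cite: SilvermanAEC2009, Prop. X.1.4] -/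
theorem depth_eq_one_of_X_eq_two_mul_sq (hsq : Squarefree n) (hodd : Odd n) (hn1 : 1 < n) (D : GenusPointData n)
    (h318 : D.lemma318) (hcomm : ∀ g g' : D.H ≃ₐ[ℚ] D.H, g * g' = g' * g)
    {X Y : ℚ} (h : (Atwo n).toAffine.Nonsingular X Y) {s : ℚ} (hs : s ≠ 0) (hX : X = 2 * s ^ 2)
    (hgen : ∀ P : (Atwo n).toAffine.Point, ∃ m : ℤ, IsOfFinAddOrder (P - m • (Point.some X Y h : (Atwo n).toAffine.Point)))
    (hnt : ¬ IsOfFinAddOrder (Point.some X Y h : (Atwo n).toAffine.Point)) :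
    (∃ y : APoint D.H, IsOfFinAddOrder
      (Point.map (W' := curveA) (D.embK n (Nat.mem_divisors_self n hsq.ne_zero)) (ΘA hsq.ne_zero (Point.some X Y h)) - (2 : ℤ) • y)) ∧
    ¬ ∃ y : APoint D.H, IsOfFinAddOrder
      (Point.map (W' := curveA) (D.embK n (Nat.mem_divisors_self n hsq.ne_zero)) (ΘA hsq.ne_zero (Point.some X Y h)) - (4 : ℤ) • y) :=
  ⟨twoDivisible_map_ΘA_of_X_eq_two_mul_sq hsq hn1 D h hs hX,
    GeneratorDepth.not_fourDivisible_map_ΘA hsq hodd hn1 D h318 hcomm hgen hnt⟩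

/-- For odd `n`, no divisor is `≡ 6 (mod 8)`; with «no divisor `≡ 5 (mod 8)`» the family has NO block. [folklore] -/
private theorem noBlock_of_odd'' (hodd : Odd n) (hnb : ∀ d ∈ n.divisors, d % 8 ≠ 5) :
    ∀ d ∈ n.divisors, d % 8 ≠ 5 ∧ d % 8 ≠ 6 := by
  intro d hd
  refine ⟨hnb d hd, fun h6 => ?_⟩
  obtain ⟨k, hk⟩ := hodd.of_dvd_nat (Nat.dvd_of_mem_divisors hd)
  omega

/-- **C⁺ ON THE INVISIBLE SPECIAL STRATUM OF THE BLOCK-FREE FAMILY ⟺ `depth P(n) = 1` EXACTLY.**  Square-free `n ≡ 7 (mod 8)` with no divisor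
`≡ 5 (mod 8)`; `ord_{s=1} L(E_n, s) = 1`; GZK; data `D` with `Printed` and `CMPointCompositumPrinted`; `ρ(n) = 0`
(`[E_n(ℚ) : φ_n(A_n(ℚ)) + E_n[2]] = 1`); the `A_n`-generator `h = (2s², Y)` (`d(h) = 2`).  Then the conclusion of `stub_offTYZ_levelTwoScriptLExact`
at `n` (`2 ∣ L ∧ 4 ∤ L` for all `L` with `𝓛(n)² = L²`) holds **iff `P(n) ∈ 2A(ℍ′_n) + tors` and `P(n) ∉ 4A(ℍ′_n) + tors`** — the half `Q₁`
of the Mordell–Weil generator has depth exactly `1` (`[Q₁] = [α_n] = 0` by this file, `Q₁ ∉ 4A + tors` by `GeneratorDepth`), and C⁺ is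
«depth P(n) = depth Q₁» (`…LevelTwoDepth`).  So on this stratum the LOWER half of C⁺ is «`[P(n)] = 0`» and the UPPER half «`P(n) ∉ 4A + tors`».
[cite: TianYuanZhang2017, §1 (p0002 L101–L110), §3.1 (p0011 L27–L36, L58–L66), Thm. 3.5 (p0011 L94–L100), Lemma 3.18 (p0017 L152–L153)]
[cite: SilvermanAEC2009, Prop. X.1.4, X.4.9] [cite: Darmon2004, Thm. 3.22] [cite: Lang2002, VI §1 Cor. 1.4] -/
theorem levelTwo_iff_depth_genusPoint_eq_one_of_X_eq_two_mul_sq (hGZK : rank_eq_analyticRank_of_analyticRank_le_one)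
    (hsq : Squarefree n) (h7 : n % 8 = 7) (hnb : ∀ d ∈ n.divisors, d % 8 ≠ 5)
    (hr : haveI := isElliptic_congruentNumberCurve hsq.ne_zero; (congruentNumberCurve n).analyticRank = 1)
    (D : GenusPointData n) (hPr : D.Printed) (hC : D.CMPointCompositumPrinted) (hρ : (rhoSubgroup n).index = 1)
    {X Y : ℚ} (h : (Atwo n).toAffine.Nonsingular X Y) {s : ℚ} (hs : s ≠ 0) (hX : X = 2 * s ^ 2)
    (hgen : ∀ P : (Atwo n).toAffine.Point, ∃ m : ℤ, IsOfFinAddOrder (P - m • (Point.some X Y h : (Atwo n).toAffine.Point))) :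
    (∀ L : ℤ, IsScriptL n L → (2 : ℤ) ∣ L ∧ ¬ (4 : ℤ) ∣ L) ↔
      ((∃ y : APoint D.H, IsOfFinAddOrder (D.P n - (2 : ℤ) • y)) ∧
        ¬ ∃ y : APoint D.H, IsOfFinAddOrder (D.P n - (4 : ℤ) • y)) := by
  haveI := isElliptic_congruentNumberCurve hsq.ne_zero
  have hn0 : n ≠ 0 := hsq.ne_zero
  have hn : n ∈ n.divisors := Nat.mem_divisors_self n hn0
  have hodd : Odd n := Nat.odd_iff.mpr (by omega)
  have hn1 : 1 < n := by omega
  have h8 : n % 8 = 5 ∨ n % 8 = 6 ∨ n % 8 = 7 := Or.inr (Or.inr h7)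
  have h35 : D.thm35Main := hPr.2.2.2.2.1
  have hLs : D.scriptLSpec := hPr.1
  have h318 : D.lemma318 := hPr.2.2.2.2.2.2.2.2.1
  obtain ⟨z, Φ, ΓH, ΓH', σ, θ, c, ρ₂, ρ₄, -, -, hcomp⟩ := hC
  have hcomm : ∀ g g' : D.H ≃ₐ[ℚ] D.H, g * g' = g' * g := fun g g' => hcomp.commute_of_noBlock (noBlock_of_odd'' hodd hnb) g g'
  have hrank : (congruentNumberCurve n).mordellWeilRank = 1 := (hGZK _ hr.le).1.trans hr
  obtain ⟨R, hR⟩ := stub_S0 (n := n) hrank.le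
  obtain ⟨Q₁, hQ₁⟩ := twist_halving hsq hn D R
  -- the half `Q₁` has depth exactly one
  have hα : GeneratesFreePart n (ΘA hn0 (Point.some X Y h)) := generatesFreePart_ΘA hn0 _ hgen
  have hQ2 : ∃ y : APoint D.H, IsOfFinAddOrder (Q₁ - (2 : ℤ) • y) :=
    (LevelTwoRhoValve.generator_twoDivisible_iff_half_twoDivisible hsq hrank.le D hρ hα hR hQ₁).mp
      (twoDivisible_map_ΘA_of_X_eq_two_mul_sq hsq hn1 D h hs hX)
  have hQ4 : ¬ ∃ y : APoint D.H, IsOfFinAddOrder (Q₁ - (4 : ℤ) • y) :=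
    GeneratorDepth.half_not_fourDivisible_of_rhoIndex_eq_one hsq hodd hn1 D h318 hcomm hrank hρ hR hQ₁
  -- `Q₁ ∈ 2^k A + tors ⟺ k ≤ 1`
  have hQk : ∀ k : ℕ, (∃ y : APoint D.H, IsOfFinAddOrder (Q₁ - ((2 : ℤ) ^ k) • y)) ↔ k ≤ 1 := by
    intro k
    constructor
    · rintro ⟨y, hy⟩
      by_contra hk
      obtain ⟨j, rfl⟩ : ∃ j, k = j + 2 := ⟨k - 2, by omega⟩
      exact hQ4 ⟨((2 : ℤ) ^ j) • y, by rwa [smul_smul, show (4 : ℤ) * 2 ^ j = 2 ^ (j + 2) by ring]⟩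
    · intro hk
      interval_cases k
      · exact ⟨Q₁, by rw [pow_zero, one_smul, sub_self]; exact IsOfFinAddOrder.zero⟩
      · rw [pow_one]; exact hQ2
  rw [LevelTwoDepth.levelTwo_iff_twoPowDivisible_iff_half hGZK hsq h8 hr D h35 hLs hR hQ₁]
  constructor
  · intro hall
    refine ⟨?_, ?_⟩
    · have := (hall 1).mpr ((hQk 1).mpr le_rfl); rwa [pow_one] at this
    · intro h4
      have : 2 ≤ 1 := (hQk 2).mp ((hall 2).mp (by rw [show ((2 : ℤ) ^ 2) = 4 by norm_num]; exact h4))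
      omega
  · rintro ⟨hP2, hP4⟩ k
    rw [hQk k]
    constructor
    · rintro ⟨y, hy⟩
      by_contra hk
      obtain ⟨j, rfl⟩ : ∃ j, k = j + 2 := ⟨k - 2, by omega⟩
      exact hP4 ⟨((2 : ℤ) ^ j) • y, by rwa [smul_smul, show (4 : ℤ) * 2 ^ j = 2 ^ (j + 2) by ring]⟩
    · intro hk
      interval_cases k
      · exact ⟨D.P n, by rw [pow_zero, one_smul, sub_self]; exact IsOfFinAddOrder.zero⟩
      · rw [pow_one]; exact hP2

end Summit.BirchSwinnertonDyer.PrintCf2.InvisibleGenerator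

end
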